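import Literature.Analysis.FluidPDE.FlatSwirlGauge
import HarnessLib

/-!
# Kinematic vortex charts and the drift-free form of the flat swirl gauge

Companion to `Literature/Analysis/FluidPDE/FlatSwirlGauge.lean` (the FLAT SWIRL GAUGE
`IsFlatSwirlGaugeOn ν u T x₀ ρ C₀ M α b d` / `HasFlatSwirlGauge ν u T x₀`, the object POSITED by route
`FlatSwirlGauge` of `NavierStokesRegularity`; not a published notion — its exactly-flat model is the swirl
`Γ = r u_θ` of axisymmetric flow with KNSS 2009 eq. (1.8), in-tree `swirl_transport_holds`). This file
splits the gauge into its KINEMATIC half and its DYNAMIC half and proves that the split is lossless —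
the vocabulary in which the route's crux `FlatGaugeAtSingularity` (item `stmt-NavierStokesRegularity-1252`)
is cut by its registered line (`Summits/…/Cruxes/FlatGaugeAtSingularity/Lines/birth.lean`), made
importable for stub proofs and negative lemmas:

* `IsVortexChartOn u T x₀ ρ C₀ M α d` — KINEMATIC VORTEX CHART on `Q_ρ(T, x₀) = (T − ρ², T) × B_ρ(x₀)`:
  the clauses of `IsFlatSwirlGaugeOn` that do not mention the drift `b` (`α ∈ C²(Q)`, `|α| ≤ M`,
  `⟪curl u, ∇α⟫ = 0` — `α` is a first integral of the vorticity, i.e. ONE Clebsch/flux coordinate of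
  `ω` (Constantin 2001; Sato 2021, §4) —, chart nondegeneracy `‖curl u‖ d ≤ C₀ ‖∇α‖` where `d > 0`,
  axis-like degeneracy set `vol({d < δ} ∩ B_ρ) ≤ C₀ δ² ρ`);
* `transportDefect ν u α t x = ∂ₜα + (u·∇)α − νΔα` (the terms of the gauge's transport clause);
* `HasDriftSizeDefectOn ν u T x₀ ρ C₁ α d` — `|transportDefect| · d ≤ ν C₁ ‖∇α‖` where `d > 0`: the flat
  transport clause with the auxiliary unknown `b` ELIMINATED;
* `driftOf ν u α = (f / (ν‖∇α‖²)) ∇α` — the canonical drift.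

## Results (all proved; no new mathematics)

* a gauge is a chart (`isVortexChartOn_of_gauge`) with drift-size defect
  (`hasDriftSizeDefectOn_of_gauge`: `f = ν⟪b, ∇α⟫`, Cauchy–Schwarz);
* conversely a chart with drift-size defect (`C₁ ≥ 0`) IS a gauge with drift `driftOf` and constant
  `max C₀ C₁` (`IsVortexChartOn.isFlatSwirlGaugeOn_driftOf`);
* hence the LOSSLESS SEAM `hasFlatSwirlGauge_iff_chart_and_defect` (`0 < ν`):
  `HasFlatSwirlGauge ν u T x₀ ↔ ∃ ρ C₀ M C₁ α d, chart ∧ 0 ≤ C₁ ∧ drift-size defect`;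
* the exactly-flat anchor restated for charts: `IsClassicalNSSolutionOn.isVortexChartOn_swirl`
  (axisymmetric `u`, `α = Γ`, `d = r`, from `IsClassicalNSSolutionOn.isFlatSwirlGaugeOn_swirl`);
* ELIMINATION OF THE DEPTH `d` (appended 2026-08-17): a chart forces the distribution-function bound
  `vol({C₀‖∇α‖ < δ‖curl u‖} ∩ B_ρ) ≤ C₀δ²ρ` (`IsVortexChartOn.volume_ratio_lt_le`), and conversely that
  bound with `0 ≤ C₀` makes `(α, ratioDepth C₀ ρ u α)` a chart (`isVortexChartOn_ratioDepth`), so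
  `(∃ d, IsVortexChartOn u T x₀ ρ C₀ M α d) ↔` "bounded `C²` first integral whose gradient dominates
  `(δ/C₀)‖curl u‖` off a set of volume `C₀δ²ρ`" (`exists_isVortexChartOn_iff`): the kinematic stub of the
  route's crux is a statement about `α` alone;
* THE INTRINSIC FORM OF THE GAUGE (appended 2026-08-17): likewise eliminating `d` from the drift-size
  defect (`defectDepth`, `gaugeDepth`, `isVortexChartOn_and_hasDriftSizeDefectOn_gaugeDepth`) gives
  `hasFlatSwirlGauge_iff_intrinsic` (`0 < ν`): `HasFlatSwirlGauge ν u T x₀ ↔ ∃ ρ C₀ M α`, `α` a bounded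
  `C²` first integral of `curl u` on `Q_ρ(T, x₀)` with
  `vol(({C₀‖∇α‖ < δ‖curl u‖} ∪ {νC₀‖∇α‖ < δ|∂ₜα + (u·∇)α − νΔα|}) ∩ B_ρ) ≤ C₀δ²ρ` — the whole v0 rendering
  of the route is a pair of distribution-function bounds on two scale-invariant ratios of ONE scalar `α`.

## Design notes

* Plain conjunctions / plain `def`s, letter for letter the corresponding clauses of `IsFlatSwirlGaugeOn`,
  so that `isVortexChartOn_of_gauge` is a projection.
* `driftOf` uses the junk arithmetic `x / 0 = 0`: it is `0` where `∇α = 0` (`driftOf_eq_zero`), which is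
  exactly what the assembly needs there (the defect bound forces `f = 0` at such points where `d > 0`).
* Deliberately NOT here: any existence statement for charts or gauges (the route's crux), maximum
  principles, the Clebsch-connection defect.

## References

* G. Koch, N. Nadirashvili, G. Seregin, V. Šverák, *Liouville theorems for the Navier–Stokes equations
  and applications*, Acta Math. 203 (2009), eq. (1.8). [KNSS2009]
* P. Constantin, *An Eulerian–Lagrangian approach to the Navier–Stokes equations*, Comm. Math. Phys. 216
  (2001) 663–686. [Constantin2001]
* N. Sato, *Realization of incompressible Navier–Stokes flow as superposition of transport processes for
  Clebsch potentials*, Phys. Fluids 33 (2021), §4. [Sato2021]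
-/

noncomputable section

open MeasureTheory Set Function Filter Metric InnerProductSpace
open scoped RealInnerProductSpace ENNReal

namespace Literature.Analysis.FluidPDE

/-- Local notation for physical space `ℝ³ = EuclideanSpace ℝ (Fin 3)`. -/
local notation "ℝ³" => EuclideanSpace ℝ (Fin 3)

/-! ### The objects of the cut -/

/-- **Kinematic vortex chart** on the backward cylinder `Q_ρ(T, x₀) = (T − ρ², T) × B_ρ(x₀)`: the clauses of
`Literature.Analysis.FluidPDE.IsFlatSwirlGaugeOn` that do not mention the drift `b` — `0 < ρ`, `ρ² < T`,
`α ∈ C²(Q)`, the axis-like degeneracy set `vol({d(t,·) < δ} ∩ B_ρ(x₀)) ≤ C₀ δ² ρ` (`0 < δ < ρ`), and at every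
`(t, x) ∈ Q`: `|α| ≤ M`, `⟪curl u, ∇α⟫ = 0` (`α` is a first integral of the vorticity), and chart
nondegeneracy `‖curl u‖ d ≤ C₀ ‖∇α‖` where `d > 0`. Kinematic half of the object posited by route
`FlatSwirlGauge` (NavierStokesRegularity); exactly-flat model `α = Γ = r u_θ`, `d = r` for axisymmetric
flow (`IsClassicalNSSolutionOn.isVortexChartOn_swirl`).
[cite: KNSS2009, eq. (1.8) (exactly-flat model; the general object is posited by route FlatSwirlGauge, not in print)] -/
def IsVortexChartOn (u : ℝ → ℝ³ → ℝ³) (T : ℝ) (x₀ : ℝ³) (ρ C₀ M : ℝ) (α : ℝ → ℝ³ → ℝ)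
    (d : ℝ → ℝ³ → ℝ) : Prop :=
  0 < ρ ∧ ρ ^ 2 < T ∧
    ContDiffOn ℝ 2 (uncurry α) (Ioo (T - ρ ^ 2) T ×ˢ ball x₀ ρ) ∧
    (∀ t ∈ Ioo (T - ρ ^ 2) T, ∀ δ ∈ Ioo 0 ρ,
      volume ({x | d t x < δ} ∩ ball x₀ ρ) ≤ ENNReal.ofReal (C₀ * δ ^ 2 * ρ)) ∧
    (∀ t ∈ Ioo (T - ρ ^ 2) T, ∀ x ∈ ball x₀ ρ,
      |α t x| ≤ M ∧ ⟪curl (u t) x, gradient (α t) x⟫ = 0 ∧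
        (0 < d t x → ‖curl (u t) x‖ * d t x ≤ C₀ * ‖gradient (α t) x‖))

/-- **Transport defect** of a momentum `α` along `u` with viscosity `ν`:
`f(t, x) = ∂ₜα + (u·∇)α − ν Δα` (two-sided `deriv` in time, `convect`, Mathlib's Laplacian — exactly the
terms of the gauge's transport clause `IsFlatSwirlGaugeOn.transport`; in the exactly-flat model `α = Γ`,
`f = −ν (2/r) ∂ᵣΓ` by KNSS 2009, (1.8)).
[cite: KNSS2009, eq. (1.8) (exactly-flat model; the general object is posited by route FlatSwirlGauge, not in print)] -/
def transportDefect (ν : ℝ) (u : ℝ → ℝ³ → ℝ³) (α : ℝ → ℝ³ → ℝ) (t : ℝ) (x : ℝ³) : ℝ :=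
  deriv (fun s => α s x) t + convect (u t) (α t) x - ν * Laplacian.laplacian (α t) x

/-- **Drift-size defect** on `Q_ρ(T, x₀)` with constant `C₁`: off the degeneracy set,
`|∂ₜα + (u·∇)α − νΔα| · d ≤ ν C₁ ‖∇α‖`. This is the flat-transport clause of the gauge with the auxiliary
drift `b` eliminated (`⟪b, ∇α⟫ = f/ν`, `‖b‖ d ≤ C₁`); exactly-flat model `α = Γ`, `d = r`, `C₁ = 2`.
[cite: KNSS2009, eq. (1.8) (exactly-flat model; the general object is posited by route FlatSwirlGauge, not in print)] -/
def HasDriftSizeDefectOn (ν : ℝ) (u : ℝ → ℝ³ → ℝ³) (T : ℝ) (x₀ : ℝ³) (ρ C₁ : ℝ)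
    (α : ℝ → ℝ³ → ℝ) (d : ℝ → ℝ³ → ℝ) : Prop :=
  ∀ t ∈ Ioo (T - ρ ^ 2) T, ∀ x ∈ ball x₀ ρ, 0 < d t x →
    |transportDefect ν u α t x| * d t x ≤ ν * C₁ * ‖gradient (α t) x‖

/-- **The canonical drift** of a momentum: `b = (f / (ν ‖∇α‖²)) ∇α` with `f` the transport defect; it is
`0` where `∇α = 0` (junk arithmetic `x / 0 = 0`), and where `∇α ≠ 0` it is the unique multiple of `∇α` with
`ν ⟪b, ∇α⟫ = f`; in the exactly-flat model it is the radial part `−(2/r)(∂ᵣΓ/‖∇Γ‖²)∇Γ` of KNSS's drift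
`−(2/r) e_r`. [cite: KNSS2009, eq. (1.8) (exactly-flat model; the general object is posited by route FlatSwirlGauge, not in print)] -/
def driftOf (ν : ℝ) (u : ℝ → ℝ³ → ℝ³) (α : ℝ → ℝ³ → ℝ) (t : ℝ) (x : ℝ³) : ℝ³ :=
  (transportDefect ν u α t x / (ν * ‖gradient (α t) x‖ ^ 2)) • gradient (α t) x

/-! ### The seam is lossless: gauge ⟺ chart with drift-size defect -/

section Seam

variable {ν T ρ C₀ M C₁ : ℝ} {u : ℝ → ℝ³ → ℝ³} {x₀ : ℝ³} {α : ℝ → ℝ³ → ℝ} {b : ℝ → ℝ³ → ℝ³}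
  {d : ℝ → ℝ³ → ℝ} {t : ℝ} {x : ℝ³}

/-- A flat swirl gauge is in particular a kinematic vortex chart (drop the two drift clauses). [folklore] -/
theorem isVortexChartOn_of_gauge (h : IsFlatSwirlGaugeOn ν u T x₀ ρ C₀ M α b d) :
    IsVortexChartOn u T x₀ ρ C₀ M α d := by
  obtain ⟨hρ, hρT, hcd, hvol, hpt⟩ := h
  exact ⟨hρ, hρT, hcd, hvol, fun t ht x hx =>
    ⟨(hpt t ht x hx).1, (hpt t ht x hx).2.1, fun hd => ((hpt t ht x hx).2.2 hd).1⟩⟩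

/-- A flat swirl gauge has transport defect of drift size with the same constant: `f = ν⟪b, ∇α⟫`, so
`|f| d ≤ ν ‖b‖ ‖∇α‖ d ≤ ν C₀ ‖∇α‖` (Cauchy–Schwarz and `‖b‖ d ≤ C₀`). [folklore] -/
theorem hasDriftSizeDefectOn_of_gauge (hν : 0 ≤ ν) (h : IsFlatSwirlGaugeOn ν u T x₀ ρ C₀ M α b d) :
    HasDriftSizeDefectOn ν u T x₀ ρ C₀ α d := by
  intro t ht x hx hd
  obtain ⟨-, hb, htr⟩ := (h.2.2.2.2 t ht x hx).2.2 hd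
  have hf : transportDefect ν u α t x = ν * ⟪b t x, gradient (α t) x⟫ := by
    unfold transportDefect
    rw [htr]
    ring
  rw [hf, abs_mul, abs_of_nonneg hν]
  calc ν * |⟪b t x, gradient (α t) x⟫| * d t x
      ≤ ν * (‖b t x‖ * ‖gradient (α t) x‖) * d t x :=
        mul_le_mul_of_nonneg_right (mul_le_mul_of_nonneg_left (abs_real_inner_le_norm _ _) hν) hd.le
    _ = ν * (‖b t x‖ * d t x) * ‖gradient (α t) x‖ := by ring
    _ ≤ ν * C₀ * ‖gradient (α t) x‖ :=
        mul_le_mul_of_nonneg_right (mul_le_mul_of_nonneg_left hb hν) (norm_nonneg _)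

/-- Where `∇α ≠ 0`, the canonical drift reproduces the defect: `⟪b, ∇α⟫ = f / ν`. [folklore] -/
theorem inner_driftOf_gradient (hν : ν ≠ 0) (hg : gradient (α t) x ≠ 0) :
    ⟪driftOf ν u α t x, gradient (α t) x⟫ = transportDefect ν u α t x / ν := by
  have hgn : ‖gradient (α t) x‖ ≠ 0 := norm_ne_zero_iff.2 hg
  rw [driftOf, real_inner_smul_left, real_inner_self_eq_norm_sq]
  field_simp

/-- Where `∇α ≠ 0`, `‖b‖ = |f| / (ν ‖∇α‖)` for the canonical drift (`0 < ν`). [folklore] -/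
theorem norm_driftOf (hν : 0 < ν) (hg : gradient (α t) x ≠ 0) :
    ‖driftOf ν u α t x‖ = |transportDefect ν u α t x| / (ν * ‖gradient (α t) x‖) := by
  have hgn : 0 < ‖gradient (α t) x‖ := norm_pos_iff.2 hg
  rw [driftOf, norm_smul, Real.norm_eq_abs, abs_div, abs_mul, abs_of_pos hν,
    abs_of_pos (by positivity : 0 < ‖gradient (α t) x‖ ^ 2)]
  field_simp

/-- Where `∇α = 0`, the canonical drift vanishes. [folklore] -/
theorem driftOf_eq_zero (hg : gradient (α t) x = 0) : driftOf ν u α t x = 0 := by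
  simp [driftOf, hg]

/-- **Assembly of the gauge from the two halves of the cut.** A kinematic vortex chart whose transport
defect is of drift size (constant `C₁ ≥ 0`) IS a flat swirl gauge with drift `b := driftOf ν u α`, the same
`α`, `d`, `ρ`, `M`, and constant `max C₀ C₁`: where `∇α ≠ 0`, `ν(Δα + ⟪b, ∇α⟫) = νΔα + f = ∂ₜα + (u·∇)α`
and `‖b‖ d = |f| d / (ν‖∇α‖) ≤ C₁`; where `∇α = 0`, `b = 0` and `|f| d ≤ 0` with `d > 0` forces `f = 0`.
[folklore] -/
theorem IsVortexChartOn.isFlatSwirlGaugeOn_driftOf (hν : 0 < ν) (h : IsVortexChartOn u T x₀ ρ C₀ M α d)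
    (hC₁ : 0 ≤ C₁) (hdef : HasDriftSizeDefectOn ν u T x₀ ρ C₁ α d) :
    IsFlatSwirlGaugeOn ν u T x₀ ρ (max C₀ C₁) M α (driftOf ν u α) d := by
  obtain ⟨hρ, hρT, hcd, hvol, hpt⟩ := h
  refine ⟨hρ, hρT, hcd, fun t ht δ hδ => ?_, fun t ht x hx => ?_⟩
  · refine (hvol t ht δ hδ).trans (ENNReal.ofReal_le_ofReal ?_)
    have h0 : 0 ≤ δ ^ 2 * ρ := by positivity
    nlinarith [le_max_left C₀ C₁, h0]
  · obtain ⟨h1, h2, h3⟩ := hpt t ht x hx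
    refine ⟨h1, h2, fun hd => ?_⟩
    have h4 := h3 hd
    have h5 := hdef t ht x hx hd
    refine ⟨h4.trans (mul_le_mul_of_nonneg_right (le_max_left _ _) (norm_nonneg _)), ?_, ?_⟩
    · -- the axis-type drift bound `‖b‖ d ≤ max C₀ C₁`
      by_cases hg : gradient (α t) x = 0
      · rw [driftOf_eq_zero hg, norm_zero, zero_mul]
        exact hC₁.trans (le_max_right _ _)
      · have hgn : 0 < ‖gradient (α t) x‖ := norm_pos_iff.2 hg
        rw [norm_driftOf hν hg]
        calc |transportDefect ν u α t x| / (ν * ‖gradient (α t) x‖) * d t x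
            = |transportDefect ν u α t x| * d t x / (ν * ‖gradient (α t) x‖) := by ring
          _ ≤ ν * C₁ * ‖gradient (α t) x‖ / (ν * ‖gradient (α t) x‖) :=
              div_le_div_of_nonneg_right h5 (by positivity)
          _ = C₁ := by field_simp
          _ ≤ max C₀ C₁ := le_max_right _ _
    · -- the flat transport law `∂ₜα + (u·∇)α = ν(Δα + ⟪b, ∇α⟫)`
      by_cases hg : gradient (α t) x = 0
      · have hf : transportDefect ν u α t x = 0 := by
          have h6 : |transportDefect ν u α t x| * d t x ≤ 0 := by
            simpa [hg] using h5
          have h7 : |transportDefect ν u α t x| ≤ 0 := by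
            by_contra h8
            push Not at h8
            have : 0 < |transportDefect ν u α t x| * d t x := mul_pos h8 hd
            linarith
          exact abs_nonpos_iff.1 h7
        rw [driftOf_eq_zero hg, inner_zero_left, add_zero]
        unfold transportDefect at hf
        linarith
      · rw [inner_driftOf_gradient hν.ne' hg]
        unfold transportDefect
        field_simp
        ring

/-- **Lossless seam.** For `0 < ν`: `u` has a flat swirl gauge at `(T, x₀)` iff it has a kinematic vortex
chart with drift-size transport defect there (forward: `C₁ := C₀ ≥ 0` by
`IsFlatSwirlGaugeOn.const_nonneg`; backward: `IsVortexChartOn.isFlatSwirlGaugeOn_driftOf`). [folklore] -/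
theorem hasFlatSwirlGauge_iff_chart_and_defect (hν : 0 < ν) :
    HasFlatSwirlGauge ν u T x₀ ↔
      ∃ (ρ C₀ M C₁ : ℝ) (α : ℝ → ℝ³ → ℝ) (d : ℝ → ℝ³ → ℝ),
        IsVortexChartOn u T x₀ ρ C₀ M α d ∧ 0 ≤ C₁ ∧ HasDriftSizeDefectOn ν u T x₀ ρ C₁ α d := by
  constructor
  · rintro ⟨ρ, C₀, M, α, b, d, hg⟩
    exact ⟨ρ, C₀, M, C₀, α, d, isVortexChartOn_of_gauge hg, hg.const_nonneg,
      hasDriftSizeDefectOn_of_gauge hν.le hg⟩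
  · rintro ⟨ρ, C₀, M, C₁, α, d, hc, hC₁, hdef⟩
    exact (hc.isFlatSwirlGaugeOn_driftOf hν hC₁ hdef).hasFlatSwirlGauge

end Seam

/-! ### The exactly-flat anchor, restated for charts -/

/-- **Axisymmetric flows carry kinematic vortex charts with `α = Γ`, `d = r`** wherever `|Γ| ≤ M` and
`‖curl u‖ r ≤ C₀ ‖∇Γ‖` (`8 ≤ C₀`): projection of the exactly-flat anchor
`IsClassicalNSSolutionOn.isFlatSwirlGaugeOn_swirl` (KNSS 2009, (1.8)). [cite: KNSS2009, eq. (1.8)] -/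
theorem IsClassicalNSSolutionOn.isVortexChartOn_swirl {ν T : ℝ} {u : ℝ → ℝ³ → ℝ³}
    {p : ℝ → ℝ³ → ℝ} (h : IsClassicalNSSolutionOn (Ico 0 T) ν 0 u p)
    (hu : ∀ t ∈ Ico 0 T, IsAxisymmetric (u t)) (hp : ∀ t ∈ Ico 0 T, IsAxisymmetricScalar (p t))
    {x₀ : ℝ³} {ρ C₀ M : ℝ} (hρ : 0 < ρ) (hρT : ρ ^ 2 < T) (hC₀ : 8 ≤ C₀)
    (hM : ∀ t ∈ Ioo (T - ρ ^ 2) T, ∀ x ∈ ball x₀ ρ, |swirl (u t) x| ≤ M)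
    (hω : ∀ t ∈ Ioo (T - ρ ^ 2) T, ∀ x ∈ ball x₀ ρ,
      ‖curl (u t) x‖ * cylRadius x ≤ C₀ * ‖gradient (swirl (u t)) x‖) :
    IsVortexChartOn u T x₀ ρ C₀ M (fun t => swirl (u t)) (fun _ => cylRadius) :=
  isVortexChartOn_of_gauge (h.isFlatSwirlGaugeOn_swirl hu hp hρ hρT hC₀ hM hω)

/-- … and that chart has drift-size transport defect with the same constant (for `0 ≤ ν`), by
`hasDriftSizeDefectOn_of_gauge`: in the model `|f| r = ν |(2/r) ∂ᵣΓ| r ≤ 2ν ‖∇Γ‖`. [cite: KNSS2009, eq. (1.8)] -/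
theorem IsClassicalNSSolutionOn.hasDriftSizeDefectOn_swirl {ν T : ℝ} {u : ℝ → ℝ³ → ℝ³}
    {p : ℝ → ℝ³ → ℝ} (h : IsClassicalNSSolutionOn (Ico 0 T) ν 0 u p) (hν : 0 ≤ ν)
    (hu : ∀ t ∈ Ico 0 T, IsAxisymmetric (u t)) (hp : ∀ t ∈ Ico 0 T, IsAxisymmetricScalar (p t))
    {x₀ : ℝ³} {ρ C₀ M : ℝ} (hρ : 0 < ρ) (hρT : ρ ^ 2 < T) (hC₀ : 8 ≤ C₀)
    (hM : ∀ t ∈ Ioo (T - ρ ^ 2) T, ∀ x ∈ ball x₀ ρ, |swirl (u t) x| ≤ M)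
    (hω : ∀ t ∈ Ioo (T - ρ ^ 2) T, ∀ x ∈ ball x₀ ρ,
      ‖curl (u t) x‖ * cylRadius x ≤ C₀ * ‖gradient (swirl (u t)) x‖) :
    HasDriftSizeDefectOn ν u T x₀ ρ C₀ (fun t => swirl (u t)) (fun _ => cylRadius) :=
  hasDriftSizeDefectOn_of_gauge hν (h.isFlatSwirlGaugeOn_swirl hu hp hρ hρT hC₀ hM hω)

/-! ### Eliminating the depth `d`: the chart is a distribution-function bound on `‖∇α‖ / ‖curl u‖` -/

section Ratio

variable {ν T ρ C₀ M : ℝ} {u : ℝ → ℝ³ → ℝ³} {x₀ : ℝ³} {α : ℝ → ℝ³ → ℝ} {d : ℝ → ℝ³ → ℝ}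

/-- **The ratio bound carried by any chart.** If `(α, d, C₀, M)` is a kinematic vortex chart on
`Q_ρ(T, x₀)` then for every admissible `t` and `δ ∈ (0, ρ)` the set where `C₀ ‖∇α‖ < δ ‖curl u‖` has volume
`≤ C₀ δ² ρ` inside the ball: at such a point `d ≥ δ` would give `‖ω‖ d ≤ C₀‖∇α‖ < δ‖ω‖ ≤ d‖ω‖`, so the set
lies in `{d < δ}`. No sign condition on `C₀` is needed. [folklore] -/
theorem IsVortexChartOn.volume_ratio_lt_le (h : IsVortexChartOn u T x₀ ρ C₀ M α d) {t : ℝ}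
    (ht : t ∈ Ioo (T - ρ ^ 2) T) {δ : ℝ} (hδ : δ ∈ Ioo 0 ρ) :
    volume ({x | C₀ * ‖gradient (α t) x‖ < δ * ‖curl (u t) x‖} ∩ ball x₀ ρ) ≤
      ENNReal.ofReal (C₀ * δ ^ 2 * ρ) := by
  refine (measure_mono ?_).trans (h.2.2.2.1 t ht δ hδ)
  rintro x ⟨hx, hxB⟩
  refine ⟨?_, hxB⟩
  rw [mem_setOf_eq] at hx ⊢
  by_contra hdx
  push Not at hdx
  have hd : 0 < d t x := hδ.1.trans_le hdx
  have h1 := (h.2.2.2.2 t ht x hxB).2.2 hd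
  have h2 : δ * ‖curl (u t) x‖ ≤ ‖curl (u t) x‖ * d t x := by
    rw [mul_comm]
    exact mul_le_mul_of_nonneg_left hdx (norm_nonneg _)
  linarith

/-- **The canonical depth** of a momentum relative to a velocity: `ρ` at stagnation points of the
vorticity, else `min ρ (C₀ ‖∇α‖ / ‖curl u‖)` — the largest depth (capped at `ρ`) compatible with chart
nondegeneracy `‖curl u‖ d ≤ C₀ ‖∇α‖`. [folklore] -/
def ratioDepth (C₀ ρ : ℝ) (u : ℝ → ℝ³ → ℝ³) (α : ℝ → ℝ³ → ℝ) (t : ℝ) (x : ℝ³) : ℝ :=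
  if curl (u t) x = 0 then ρ else min ρ (C₀ * ‖gradient (α t) x‖ / ‖curl (u t) x‖)

/-- **Charts from the ratio bound.** Conversely, if `0 < ρ`, `ρ² < T`, `α ∈ C²(Q_ρ(T, x₀))`, `|α| ≤ M`,
`⟪curl u, ∇α⟫ = 0` on the cylinder, `0 ≤ C₀`, and for all admissible `t` and `δ ∈ (0, ρ)` the set
`{C₀ ‖∇α‖ < δ ‖curl u‖} ∩ B_ρ(x₀)` has volume `≤ C₀ δ² ρ`, then `(α, ratioDepth C₀ ρ u α, C₀, M)` is a
kinematic vortex chart: `{ratioDepth < δ} ⊆ {C₀‖∇α‖ < δ‖ω‖}` for `δ < ρ`, and `‖ω‖ · ratioDepth ≤ C₀ ‖∇α‖`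
by construction. So the depth `d` carries no information beyond this distribution-function bound. [folklore] -/
theorem isVortexChartOn_ratioDepth (hρ : 0 < ρ) (hρT : ρ ^ 2 < T)
    (hcd : ContDiffOn ℝ 2 (uncurry α) (Ioo (T - ρ ^ 2) T ×ˢ ball x₀ ρ))
    (hM : ∀ t ∈ Ioo (T - ρ ^ 2) T, ∀ x ∈ ball x₀ ρ, |α t x| ≤ M)
    (hfirst : ∀ t ∈ Ioo (T - ρ ^ 2) T, ∀ x ∈ ball x₀ ρ, ⟪curl (u t) x, gradient (α t) x⟫ = 0)
    (hC₀ : 0 ≤ C₀)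
    (hvol : ∀ t ∈ Ioo (T - ρ ^ 2) T, ∀ δ ∈ Ioo 0 ρ,
      volume ({x | C₀ * ‖gradient (α t) x‖ < δ * ‖curl (u t) x‖} ∩ ball x₀ ρ) ≤
        ENNReal.ofReal (C₀ * δ ^ 2 * ρ)) :
    IsVortexChartOn u T x₀ ρ C₀ M α (ratioDepth C₀ ρ u α) := by
  refine ⟨hρ, hρT, hcd, fun t ht δ hδ => (measure_mono ?_).trans (hvol t ht δ hδ), fun t ht x hx =>
    ⟨hM t ht x hx, hfirst t ht x hx, fun hd => ?_⟩⟩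
  · rintro x ⟨hx, hxB⟩
    refine ⟨?_, hxB⟩
    rw [mem_setOf_eq] at hx ⊢
    unfold ratioDepth at hx
    split_ifs at hx with hω
    · exact absurd hx (not_lt.2 hδ.2.le)
    · have hωpos : 0 < ‖curl (u t) x‖ := norm_pos_iff.2 hω
      have hq : C₀ * ‖gradient (α t) x‖ / ‖curl (u t) x‖ < δ := by
        rcases lt_or_ge (C₀ * ‖gradient (α t) x‖ / ‖curl (u t) x‖) ρ with hlt | hge
        · rwa [min_eq_right hlt.le] at hx
        · rw [min_eq_left hge] at hx
          exact absurd hx (not_lt.2 hδ.2.le)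
      rwa [div_lt_iff₀ hωpos] at hq
  · unfold ratioDepth at hd ⊢
    split_ifs with hω
    · rw [hω, norm_zero, zero_mul]
      exact mul_nonneg hC₀ (norm_nonneg _)
    · have hωpos : 0 < ‖curl (u t) x‖ := norm_pos_iff.2 hω
      calc ‖curl (u t) x‖ * min ρ (C₀ * ‖gradient (α t) x‖ / ‖curl (u t) x‖)
          ≤ ‖curl (u t) x‖ * (C₀ * ‖gradient (α t) x‖ / ‖curl (u t) x‖) :=
            mul_le_mul_of_nonneg_left (min_le_right _ _) hωpos.le
        _ = C₀ * ‖gradient (α t) x‖ := by field_simp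

/-- **The depth-free form of the kinematic chart** (`0 ≤ C₀`): some depth `d` makes `(α, d, C₀, M)` a
kinematic vortex chart on `Q_ρ(T, x₀)` iff `α` is a bounded `C²` first integral of the vorticity on the
cylinder whose gradient dominates `(δ/C₀) ‖curl u‖` off a set of volume `C₀ δ² ρ`, for every
`δ ∈ (0, ρ)`. [folklore] -/
theorem exists_isVortexChartOn_iff (hC₀ : 0 ≤ C₀) :
    (∃ d : ℝ → ℝ³ → ℝ, IsVortexChartOn u T x₀ ρ C₀ M α d) ↔
      0 < ρ ∧ ρ ^ 2 < T ∧ ContDiffOn ℝ 2 (uncurry α) (Ioo (T - ρ ^ 2) T ×ˢ ball x₀ ρ) ∧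
        (∀ t ∈ Ioo (T - ρ ^ 2) T, ∀ x ∈ ball x₀ ρ,
          |α t x| ≤ M ∧ ⟪curl (u t) x, gradient (α t) x⟫ = 0) ∧
        ∀ t ∈ Ioo (T - ρ ^ 2) T, ∀ δ ∈ Ioo 0 ρ,
          volume ({x | C₀ * ‖gradient (α t) x‖ < δ * ‖curl (u t) x‖} ∩ ball x₀ ρ) ≤
            ENNReal.ofReal (C₀ * δ ^ 2 * ρ) := by
  constructor
  · rintro ⟨d, h⟩
    exact ⟨h.1, h.2.1, h.2.2.1, fun t ht x hx => ⟨(h.2.2.2.2 t ht x hx).1, (h.2.2.2.2 t ht x hx).2.1⟩,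
      fun t ht δ hδ => h.volume_ratio_lt_le ht hδ⟩
  · rintro ⟨hρ, hρT, hcd, hpt, hvol⟩
    exact ⟨_, isVortexChartOn_ratioDepth hρ hρT hcd (fun t ht x hx => (hpt t ht x hx).1)
      (fun t ht x hx => (hpt t ht x hx).2) hC₀ hvol⟩

end Ratio

/-! ### The intrinsic form of the flat swirl gauge: a statement about `α` alone -/

section Intrinsic

variable {ν T ρ C₀ C₁ M : ℝ} {u : ℝ → ℝ³ → ℝ³} {x₀ : ℝ³} {α : ℝ → ℝ³ → ℝ} {d : ℝ → ℝ³ → ℝ}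
  {t δ : ℝ} {x : ℝ³}

/-- The sublevel set `{C₀‖∇α‖ < δ‖curl u‖}` of a chart lies in `{d < δ}` (inside the ball): at such a point
`d ≥ δ` would give `‖ω‖ d ≤ C₀‖∇α‖ < δ‖ω‖ ≤ d‖ω‖`. [folklore] -/
theorem IsVortexChartOn.ratio_lt_subset (h : IsVortexChartOn u T x₀ ρ C₀ M α d)
    (ht : t ∈ Ioo (T - ρ ^ 2) T) (hδ : δ ∈ Ioo 0 ρ) :
    {x | C₀ * ‖gradient (α t) x‖ < δ * ‖curl (u t) x‖} ∩ ball x₀ ρ ⊆ {x | d t x < δ} ∩ ball x₀ ρ := by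
  rintro x ⟨hx, hxB⟩
  refine ⟨?_, hxB⟩
  rw [mem_setOf_eq] at hx ⊢
  by_contra hdx
  push Not at hdx
  have hd : 0 < d t x := hδ.1.trans_le hdx
  have h1 := (h.2.2.2.2 t ht x hxB).2.2 hd
  have h2 : δ * ‖curl (u t) x‖ ≤ ‖curl (u t) x‖ * d t x := by
    rw [mul_comm]
    exact mul_le_mul_of_nonneg_left hdx (norm_nonneg _)
  linarith

/-- The sublevel set `{ν C₁ ‖∇α‖ < δ |f|}` of a depth with drift-size defect (constant `C₁`) lies in
`{d < δ}` (inside the ball): at such a point `d ≥ δ` would give `|f| d ≤ ν C₁ ‖∇α‖ < δ |f| ≤ d |f|`.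
[folklore] -/
theorem HasDriftSizeDefectOn.defectRatio_lt_subset (hdef : HasDriftSizeDefectOn ν u T x₀ ρ C₁ α d)
    (ht : t ∈ Ioo (T - ρ ^ 2) T) (hδ : δ ∈ Ioo 0 ρ) :
    {x | ν * C₁ * ‖gradient (α t) x‖ < δ * |transportDefect ν u α t x|} ∩ ball x₀ ρ ⊆
      {x | d t x < δ} ∩ ball x₀ ρ := by
  rintro x ⟨hx, hxB⟩
  refine ⟨?_, hxB⟩
  rw [mem_setOf_eq] at hx ⊢
  by_contra hdx
  push Not at hdx
  have hd : 0 < d t x := hδ.1.trans_le hdx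
  have h1 := hdef t ht x hxB hd
  have h2 : δ * |transportDefect ν u α t x| ≤ |transportDefect ν u α t x| * d t x := by
    rw [mul_comm]
    exact mul_le_mul_of_nonneg_left hdx (abs_nonneg _)
  linarith

/-- **The joint ratio bound carried by a chart with drift-size defect**: the union of the two sublevel
sets has volume `≤ C₀ δ² ρ` inside the ball (both lie in `{d < δ}`). [folklore] -/
theorem IsVortexChartOn.volume_union_ratio_lt_le (h : IsVortexChartOn u T x₀ ρ C₀ M α d)
    (hdef : HasDriftSizeDefectOn ν u T x₀ ρ C₁ α d) (ht : t ∈ Ioo (T - ρ ^ 2) T) (hδ : δ ∈ Ioo 0 ρ) :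
    volume (({x | C₀ * ‖gradient (α t) x‖ < δ * ‖curl (u t) x‖} ∪
        {x | ν * C₁ * ‖gradient (α t) x‖ < δ * |transportDefect ν u α t x|}) ∩ ball x₀ ρ) ≤
      ENNReal.ofReal (C₀ * δ ^ 2 * ρ) := by
  refine (measure_mono ?_).trans (h.2.2.2.1 t ht δ hδ)
  rw [union_inter_distrib_right]
  exact union_subset (h.ratio_lt_subset ht hδ) (hdef.defectRatio_lt_subset ht hδ)

/-- Reading off the first ratio inequality from `ratioDepth < δ` (`δ < ρ`). [folklore] -/
theorem ratio_lt_of_ratioDepth_lt (hδ : δ ∈ Ioo 0 ρ) (hx : ratioDepth C₀ ρ u α t x < δ) :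
    C₀ * ‖gradient (α t) x‖ < δ * ‖curl (u t) x‖ := by
  unfold ratioDepth at hx
  split_ifs at hx with hω
  · exact absurd hx (not_lt.2 hδ.2.le)
  · have hωpos : 0 < ‖curl (u t) x‖ := norm_pos_iff.2 hω
    have hq : C₀ * ‖gradient (α t) x‖ / ‖curl (u t) x‖ < δ := by
      rcases lt_or_ge (C₀ * ‖gradient (α t) x‖ / ‖curl (u t) x‖) ρ with hlt | hge
      · rwa [min_eq_right hlt.le] at hx
      · rw [min_eq_left hge] at hx
        exact absurd hx (not_lt.2 hδ.2.le)
    rwa [div_lt_iff₀ hωpos] at hq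

/-- **The canonical defect depth** of a momentum: `ρ` where the transport defect `f` vanishes, else
`ν C₀ ‖∇α‖ / |f|` — the largest depth compatible with the drift-size bound `|f| d ≤ ν C₀ ‖∇α‖`. [folklore] -/
def defectDepth (ν C₀ ρ : ℝ) (u : ℝ → ℝ³ → ℝ³) (α : ℝ → ℝ³ → ℝ) (t : ℝ) (x : ℝ³) : ℝ :=
  if transportDefect ν u α t x = 0 then ρ
  else ν * C₀ * ‖gradient (α t) x‖ / |transportDefect ν u α t x|

/-- **The canonical gauge depth**: the smaller of the chart depth `ratioDepth` and the defect depth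
`defectDepth`. [folklore] -/
def gaugeDepth (ν C₀ ρ : ℝ) (u : ℝ → ℝ³ → ℝ³) (α : ℝ → ℝ³ → ℝ) (t : ℝ) (x : ℝ³) : ℝ :=
  min (ratioDepth C₀ ρ u α t x) (defectDepth ν C₀ ρ u α t x)

/-- Reading off the second ratio inequality from `defectDepth < δ` (`δ < ρ`). [folklore] -/
theorem defectRatio_lt_of_defectDepth_lt (hδ : δ ∈ Ioo 0 ρ) (hx : defectDepth ν C₀ ρ u α t x < δ) :
    ν * C₀ * ‖gradient (α t) x‖ < δ * |transportDefect ν u α t x| := by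
  unfold defectDepth at hx
  split_ifs at hx with hf
  · exact absurd hx (not_lt.2 hδ.2.le)
  · rwa [div_lt_iff₀ (abs_pos.2 hf)] at hx

/-- The defect depth realises the drift-size bound: `|f| · defectDepth ≤ ν C₀ ‖∇α‖` (`0 ≤ ν C₀ ‖∇α‖`
needed only where `f = 0`). [folklore] -/
theorem abs_transportDefect_mul_defectDepth_le (hνC : 0 ≤ ν * C₀) :
    |transportDefect ν u α t x| * defectDepth ν C₀ ρ u α t x ≤ ν * C₀ * ‖gradient (α t) x‖ := by
  unfold defectDepth
  split_ifs with hf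
  · rw [hf, abs_zero, zero_mul]
    exact mul_nonneg hνC (norm_nonneg _)
  · have hfpos : 0 < |transportDefect ν u α t x| := abs_pos.2 hf
    rw [mul_div_assoc', mul_div_cancel_left₀ _ hfpos.ne']

/-- **Chart and drift-size defect from the joint ratio bound.** If `0 < ρ`, `ρ² < T`, `α ∈ C²(Q)`,
`|α| ≤ M`, `⟪curl u, ∇α⟫ = 0`, `0 ≤ C₀`, `0 ≤ ν`, and for all admissible `t`, `δ ∈ (0, ρ)` the union
`{C₀‖∇α‖ < δ‖curl u‖} ∪ {νC₀‖∇α‖ < δ|f|}` has volume `≤ C₀ δ² ρ` inside `B_ρ(x₀)`, then with the depth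
`gaugeDepth ν C₀ ρ u α` the momentum `α` is a kinematic vortex chart with drift-size defect (both
constants `C₀`). [folklore] -/
theorem isVortexChartOn_and_hasDriftSizeDefectOn_gaugeDepth (hρ : 0 < ρ) (hρT : ρ ^ 2 < T)
    (hcd : ContDiffOn ℝ 2 (uncurry α) (Ioo (T - ρ ^ 2) T ×ˢ ball x₀ ρ))
    (hM : ∀ t ∈ Ioo (T - ρ ^ 2) T, ∀ x ∈ ball x₀ ρ, |α t x| ≤ M)
    (hfirst : ∀ t ∈ Ioo (T - ρ ^ 2) T, ∀ x ∈ ball x₀ ρ, ⟪curl (u t) x, gradient (α t) x⟫ = 0)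
    (hC₀ : 0 ≤ C₀) (hν : 0 ≤ ν)
    (hvol : ∀ t ∈ Ioo (T - ρ ^ 2) T, ∀ δ ∈ Ioo 0 ρ,
      volume (({x | C₀ * ‖gradient (α t) x‖ < δ * ‖curl (u t) x‖} ∪
          {x | ν * C₀ * ‖gradient (α t) x‖ < δ * |transportDefect ν u α t x|}) ∩ ball x₀ ρ) ≤
        ENNReal.ofReal (C₀ * δ ^ 2 * ρ)) :
    IsVortexChartOn u T x₀ ρ C₀ M α (gaugeDepth ν C₀ ρ u α) ∧
      HasDriftSizeDefectOn ν u T x₀ ρ C₀ α (gaugeDepth ν C₀ ρ u α) := by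
  -- the chart with the larger depth `ratioDepth` (first ratio bound alone)
  have hchart : IsVortexChartOn u T x₀ ρ C₀ M α (ratioDepth C₀ ρ u α) :=
    isVortexChartOn_ratioDepth hρ hρT hcd hM hfirst hC₀ fun t ht δ hδ =>
      (measure_mono (inter_subset_inter_left _ subset_union_left)).trans (hvol t ht δ hδ)
  refine ⟨⟨hρ, hρT, hcd, fun t ht δ hδ => (measure_mono ?_).trans (hvol t ht δ hδ),
    fun t ht x hx => ⟨hM t ht x hx, hfirst t ht x hx, fun hd => ?_⟩⟩, fun t ht x hx hd => ?_⟩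
  · -- `{gaugeDepth < δ} ∩ B ⊆ ({C₀‖∇α‖ < δ‖ω‖} ∪ {νC₀‖∇α‖ < δ|f|}) ∩ B`
    rintro x ⟨hx, hxB⟩
    refine ⟨?_, hxB⟩
    rw [mem_setOf_eq, gaugeDepth] at hx
    rcases min_lt_iff.1 hx with h1 | h1
    · exact Or.inl (ratio_lt_of_ratioDepth_lt hδ h1)
    · exact Or.inr (defectRatio_lt_of_defectDepth_lt hδ h1)
  · -- chart nondegeneracy: `‖ω‖ · gaugeDepth ≤ ‖ω‖ · ratioDepth ≤ C₀‖∇α‖`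
    have hd' : 0 < ratioDepth C₀ ρ u α t x := hd.trans_le (min_le_left _ _)
    calc ‖curl (u t) x‖ * gaugeDepth ν C₀ ρ u α t x
        ≤ ‖curl (u t) x‖ * ratioDepth C₀ ρ u α t x :=
          mul_le_mul_of_nonneg_left (min_le_left _ _) (norm_nonneg _)
      _ ≤ C₀ * ‖gradient (α t) x‖ := (hchart.2.2.2.2 t ht x hx).2.2 hd'
  · -- drift-size defect: `|f| · gaugeDepth ≤ |f| · defectDepth ≤ νC₀‖∇α‖`
    calc |transportDefect ν u α t x| * gaugeDepth ν C₀ ρ u α t x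
        ≤ |transportDefect ν u α t x| * defectDepth ν C₀ ρ u α t x :=
          mul_le_mul_of_nonneg_left (min_le_right _ _) (abs_nonneg _)
      _ ≤ ν * C₀ * ‖gradient (α t) x‖ := abs_transportDefect_mul_defectDepth_le (mul_nonneg hν hC₀)

/-- **The intrinsic form of the flat swirl gauge** (`0 < ν`). `u` has a flat swirl gauge at `(T, x₀)`
iff there are `ρ, C₀ ≥ 0, M` and a momentum `α` ALONE — `C²` on `Q_ρ(T, x₀)`, `|α| ≤ M`, a first integral of
the vorticity — whose two scale-invariant ratios `‖∇α‖/‖curl u‖` and `ν‖∇α‖/|∂ₜα + (u·∇)α − νΔα|` are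
small only on an axis-like thin set: `vol(({C₀‖∇α‖ < δ‖curl u‖} ∪ {νC₀‖∇α‖ < δ|f|}) ∩ B_ρ(x₀)) ≤ C₀δ²ρ`
for all admissible `t` and `δ ∈ (0, ρ)`. The auxiliary data `b` (drift) and `d` (depth) of the route's
rendering carry no further information (`driftOf`, `gaugeDepth`). [folklore] -/
theorem hasFlatSwirlGauge_iff_intrinsic (hν : 0 < ν) :
    HasFlatSwirlGauge ν u T x₀ ↔
      ∃ (ρ C₀ M : ℝ) (α : ℝ → ℝ³ → ℝ), 0 ≤ C₀ ∧ 0 < ρ ∧ ρ ^ 2 < T ∧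
        ContDiffOn ℝ 2 (uncurry α) (Ioo (T - ρ ^ 2) T ×ˢ ball x₀ ρ) ∧
        (∀ t ∈ Ioo (T - ρ ^ 2) T, ∀ x ∈ ball x₀ ρ,
          |α t x| ≤ M ∧ ⟪curl (u t) x, gradient (α t) x⟫ = 0) ∧
        ∀ t ∈ Ioo (T - ρ ^ 2) T, ∀ δ ∈ Ioo 0 ρ,
          volume (({x | C₀ * ‖gradient (α t) x‖ < δ * ‖curl (u t) x‖} ∪
              {x | ν * C₀ * ‖gradient (α t) x‖ < δ * |transportDefect ν u α t x|}) ∩ ball x₀ ρ) ≤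
            ENNReal.ofReal (C₀ * δ ^ 2 * ρ) := by
  constructor
  · rintro ⟨ρ, C₀, M, α, b, d, hg⟩
    have hc := isVortexChartOn_of_gauge hg
    have hdef := hasDriftSizeDefectOn_of_gauge hν.le hg
    exact ⟨ρ, C₀, M, α, hg.const_nonneg, hc.1, hc.2.1, hc.2.2.1,
      fun t ht x hx => ⟨(hc.2.2.2.2 t ht x hx).1, (hc.2.2.2.2 t ht x hx).2.1⟩,
      fun t ht δ hδ => hc.volume_union_ratio_lt_le hdef ht hδ⟩
  · rintro ⟨ρ, C₀, M, α, hC₀, hρ, hρT, hcd, hpt, hvol⟩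
    obtain ⟨hc, hdef⟩ := isVortexChartOn_and_hasDriftSizeDefectOn_gaugeDepth hρ hρT hcd
      (fun t ht x hx => (hpt t ht x hx).1) (fun t ht x hx => (hpt t ht x hx).2) hC₀ hν.le hvol
    exact (hc.isFlatSwirlGaugeOn_driftOf hν hC₀ hdef).hasFlatSwirlGauge

end Intrinsic

end Literature.Analysis.FluidPDE

end
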